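import Mathlib
import Literature.MathematicalPhysics.QuantumFieldTheory.IsingGaugeHighTemperatureExpansion
import Literature.MathematicalPhysics.QuantumFieldTheory.PlaquetteRandomClusterDualityThree
import HarnessLib

/-!
# Wegner's duality for Ising (`ℤ₂`) lattice gauge theory on the torus: the gauge theory at `β` is the
# generalized Ising model `M*_{d,d-2}` on the dual lattice at `K*`, `tanh 2β = e^{-2K*}`, summed over
# the `H₂`-twists — PROVED on `𝕋^d_L` (for `d = 3`: the Ising model on the dual torus)

Companion of `IsingGaugeHighTemperatureExpansion` (the high-temperature expansion
`Z_β[γ] = |Ω¹| (cosh 2β)^{|C₂⁺|} Σ_{η : ∂η = γ} (tanh 2β)^{|supp η|}`, PROVED there) and of the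
cubical-duality files (`PlaquetteRandomClusterGiantCycles`: the `3`-cells `Cell₃ d L` and
`∂₃ = bd₃`; `PlaquetteRandomClusterDuality`: `bd₂_bd₃` (`∂₂∂₃ = 0`); `PlaquetteRandomClusterDualityThree`:
on `𝕋³_L` the `3`-cells are the cubes `≃ Site 3 L`, the dual cell of a plaquette is the bond between
the two cubes it separates, `bd₃_apply_three`).

Sources.
* F. J. Wegner, *Duality in generalized Ising models and phase transitions without local order
  parameters*, J. Math. Phys. **12** (1971) 2259 [Wegner1971], §III.A: the models `M_{dn}` (Ising
  spins on the `(n-1)`-cells of a hypercubic lattice, one interaction term per `n`-cell) and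
  `M*_{d,d-n}` on the dual lattice "are related by the duality relation" eq. (3.27)
  `Y_{dn}(K,0) = Y*_{d,d-n}(K*,0)` with eq. (3.28) `tanh K = e^{-2K*}`, exactly for spherical
  boundary conditions; "for systems with periodic boundary conditions one obtains `N_m = (d choose n)`"
  extra degeneracy factors `2^{N_m}`, negligible in the thermodynamic limit, eq. (3.30)
  [read in the reprint: corpus book `editornd-lattice-gauge-theories-monte-carlo-simulations`,
  pp. 78–79]. `M_{d,2}` is Ising lattice gauge theory; `M*_{3,1}` is the Ising model on the dual
  cubic lattice; `M*_{4,2}` is again the gauge theory (self-duality in `d = 4`).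
* A. Wipf, *Statistical Approach to Quantum Field Theory* (2nd ed., 2021) [Wipf2021], §10.3,
  eqs. (10.40)–(10.45): "the three-dimensional Ising model is dual to a `Z₂` gauge theory",
  `*K = -½ log tanh K`.
* M. Aizenman, J. T. Chayes, L. Chayes, J. Fröhlich, L. Russo, CMP **92** (1983)
  [AizenmanChayesChayesFrohlichRusso1983]: the duality `ℤ₂` lattice gauge theory in `d = 3` ↔ Ising
  model underlying the sharp area-law/perimeter-law transition (census row A5; only the duality is
  typed here, not the percolation estimates).

## Scope (read this first)

Gauge group `ℤ₂` only; finite torus. Nothing here bears on the Yang–Mills mass gap or on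
`BalabanLadder.IR`; in the `ym` ladder only the conditional finite-`𝕋⁴` rung `BalabanLadder.UV` is
closed by any route. Typed for the `ym-ir` census (row A5, "locator-only": the Kramers–Wannier–Wegner
duality half is now an exact theorem on the torus; row A9: another graphical identity for `Z_β[γ]`).

## What is typed (transcriber's form, flagged)

* THE DUAL MODEL. Wegner's `M*_{d,d-2}`: `ℤ₂` spins `s` on the `3`-cells of `𝕋^d_L` (the dual
  `(d-3)`-cells), one coupling `K ρ(Σ_{c ∋ σ} s(c)) = K ρ((∂₃ s)(σ))` per plaquette `σ` (the dual
  `(d-2)`-cell, whose dual boundary consists of the duals of the `3`-cells containing `σ`), twisted by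
  a `ℤ₂` `2`-form `τ` (antiperiodic seams): `Z*_K[τ] = Σ_s ∏_σ exp(K ρ((∂₃ s)(σ) + τ(σ)))`
  (`dualSpinZ`). For `d = 3` this is the nearest-neighbour Ising model on the dual torus (spins on
  cubes; `bd₃_apply_three`: `(∂₃ s)(z; a<b) = ±(s(z - e_c) - s(z))`), with the couplings across the
  plaquettes of `supp τ` reversed; for `d = 4` it is `ℤ₂` gauge theory on the dual lattice (one
  factor `e^{Kρ}` per dual plaquette; the identification with `loopNumerator` on the dual `𝕋⁴_L` via
  `PlaquetteRandomClusterDualityCubical.dualPlaq` is not typed here).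
* THE TORUS REFINEMENT (Wegner's periodic-boundary remark made exact): on `𝕋^d_L` a `2`-cycle need
  not bound, so the high-temperature side `Σ_{∂η = γ}` runs over a union of `H₂(𝕋^d_L; ℤ₂)`-cosets
  of `2`-boundaries while one twisted dual partition function only sees one coset. The exact finite
  identity typed here SUMS OVER ALL TWISTS with prescribed boundary:
  `Σ_{τ : ∂τ = γ} Z*_K[τ] = 2^{|C₃|} e^{K|C₂⁺|} Σ_{η : ∂η = γ} (e^{-2K})^{|supp η|}`
  (each twist class modulo `∂₃C₃` is counted `|∂₃C₃|` times and `Z*_K[τ]` depends only on the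
  class, `dualSpinZ_add_bd₃`; we do not pass to the quotient `H₂(𝕋^d_L;ℤ₂)`), hence with
  `e^{-2K} = tanh 2β` (Wegner's (3.28) with `K_gauge = 2β`, reading R2 of
  `IsingGaugeRandomCurrents`): `Σ_{τ : ∂τ = γ} Z*_K[τ] = 2^{|C₃|} e^{K|C₂⁺|} Z_β[γ] / (|Ω¹| (cosh 2β)^{|C₂⁺|})`
  and the disorder-operator form of Wilson loops `𝔼_β[W_γ] = Σ_{∂τ = γ} Z*_K[τ] / Σ_{∂τ = 0} Z*_K[τ]`.
  `-- TODO(general form): spherical / free boundary conditions, where the sum has one term.`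

## Contents (everything PROVED; no named fact)

* `dualSpinZ` (`Z*_K[τ]`), `dualSpinZ_eq_lowTemp` (the low-temperature / Peierls expansion
  `Z*_K[τ] = e^{K|C₂⁺|} Σ_s (e^{-2K})^{|supp(∂₃s + τ)|}`), `dualSpinZ_add_bd₃` (a twist is defined modulo
  `2`-boundaries), `sum_dualSpinZ_eq` (the sum over twists, every `K`, `γ`, `d`);
* `dualCoupling β = -½ log tanh 2β`, `exp_neg_two_mul_dualCoupling`, `dualCoupling_pos`;
* **Wegner's duality on the torus** `sum_dualSpinZ_eq_loopNumerator` and the Wilson-loop form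
  `wilsonExpect_eq_dualSpinZ_ratio`;
* for `d = 3`: `bd₃_eq_zero_iff_const` (`ker ∂₃ = ` the constants on `𝕋³_L`, `ℤ₂` coefficients),
  `card_fibre_bd₃_three`, `dualSpinZ_three_eq` (one twisted Ising partition function = `2 e^{K|C₂⁺|}` ×
  the sum over ONE coset `τ + ∂₃C₃`), `dualSpinZ_three_zero_eq` (untwisted: the `2`-boundaries only)
  and `dualSpinZ_three_zero_le` (the Ising model on the dual torus is the trivial sector: a lower
  bound for the gauge side).
-/

open Finset

namespace Literature.MathematicalPhysics.QuantumFieldTheory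

namespace IsingGaugeCurrents

open LatticeForm PlaquetteRC

variable {d L : ℕ} [NeZero L]

/-! ### Wegner's dual model `M*_{d,d-2}` with a twist -/

/-- **The twisted dual-spin partition function** `Z*_K[τ] = Σ_{s ∈ ℤ₂^{C₃}} ∏_σ exp(K ρ((∂₃ s)(σ) + τ(σ)))`:
Wegner's generalized Ising model `M*_{d,d-2}` on the dual lattice (spins on the `3`-cells of `𝕋^d_L`, one
bond per plaquette; `d = 3`: the Ising model on the dual torus, `d = 4`: `ℤ₂` gauge theory on the dual
lattice), with the couplings across `supp τ` reversed. [cite: Wegner1971, §III.A eqs. (3.12)–(3.15) (M_{dn}, M*_{d,d-n})] -/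
noncomputable def dualSpinZ (K : ℝ) (τ : Plaquette d L → ZMod 2) : ℝ :=
  ∑ s : Cell₃ d L → ZMod 2, ∏ σ : Plaquette d L, Real.exp (K * spin ((bd₃ s + τ) σ))

/-- `exp(K ρ(x)) = e^K (e^{-2K})^{𝟙[x ≠ 0]}` on `ℤ₂`. [cite: Wipf2021, §10.3 eq. (10.40)] -/
theorem exp_mul_spin (K : ℝ) (x : ZMod 2) :
    Real.exp (K * spin x) = Real.exp K * (if x = 0 then 1 else Real.exp (-(2 * K))) := by
  unfold spin
  split_ifs
  · rw [mul_one, mul_one]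
  · rw [← Real.exp_add, show K * (-1 : ℝ) = K + -(2 * K) by ring]

/-- The Boltzmann weight of one dual configuration: `∏_σ exp(K ρ(ξ(σ))) = e^{K|C₂⁺|} (e^{-2K})^{|supp ξ|}`.
[cite: Wipf2021, §10.3 eqs. (10.39)–(10.40)] -/
theorem prod_exp_mul_spin (K : ℝ) (ξ : Plaquette d L → ZMod 2) :
    ∏ σ : Plaquette d L, Real.exp (K * spin (ξ σ)) =
      Real.exp K ^ Fintype.card (Plaquette d L) * Real.exp (-(2 * K)) ^ (supp ξ).card := by
  classical
  unfold supp
  simp_rw [exp_mul_spin]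
  rw [Finset.prod_mul_distrib, Finset.prod_const, Finset.card_univ, Finset.prod_ite,
    Finset.prod_const_one, one_mul, Finset.prod_const]

/-- **The low-temperature expansion of the dual model**:
`Z*_K[τ] = e^{K|C₂⁺|} Σ_s (e^{-2K})^{|supp(∂₃ s + τ)|}` (unsatisfied dual bonds = the plaquettes of
`supp(∂₃ s + τ)`). [cite: Wipf2021, §10.3 eqs. (10.39)–(10.40)] -/
theorem dualSpinZ_eq_lowTemp (K : ℝ) (τ : Plaquette d L → ZMod 2) :
    dualSpinZ K τ = Real.exp K ^ Fintype.card (Plaquette d L) *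
      ∑ s : Cell₃ d L → ZMod 2, Real.exp (-(2 * K)) ^ (supp (bd₃ s + τ)).card := by
  unfold dualSpinZ
  rw [Finset.mul_sum]
  exact Finset.sum_congr rfl fun s _ => prod_exp_mul_spin K (bd₃ s + τ)

/-- `∂₃` is additive on `ℤ₂` `3`-chains. [cite: DuncanSchweinhart2025, §2.1 (∂ linear)] -/
theorem bd₃_add (s v : Cell₃ d L → ZMod 2) : bd₃ (s + v) = bd₃ s + bd₃ v := by
  have := (bd₃Lin (d := d) (L := L) (ZMod 2)).map_add s v
  simpa only [bd₃Lin_apply] using this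

/-- **A twist is defined modulo `2`-boundaries**: `Z*_K[τ + ∂₃ v] = Z*_K[τ]` (absorb `v` into the spins;
for `d = 3` a "gauge transformation of the seam"). [cite: Wegner1971, §III.A (closure condition, eqs. (3.18)–(3.20))] -/
theorem dualSpinZ_add_bd₃ (K : ℝ) (τ : Plaquette d L → ZMod 2) (v : Cell₃ d L → ZMod 2) :
    dualSpinZ K (τ + bd₃ v) = dualSpinZ K τ := by
  unfold dualSpinZ
  rw [← Equiv.sum_comp (Equiv.addRight v)]
  refine Finset.sum_congr rfl fun s _ => ?_
  have h2 : ∀ a : ZMod 2, a + a = 0 := by decide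
  have hfun : bd₃ (Equiv.addRight v s) + (τ + bd₃ v) = bd₃ s + τ := by
    rw [Equiv.coe_addRight, bd₃_add]
    funext σ
    simp only [Pi.add_apply]
    calc bd₃ s σ + bd₃ v σ + (τ σ + bd₃ v σ) = bd₃ s σ + τ σ + (bd₃ v σ + bd₃ v σ) := by ring
      _ = bd₃ s σ + τ σ := by rw [h2, add_zero]
  rw [hfun]

/-- **The sum over twists with prescribed boundary** (every `K`, `γ`, `d`):
`Σ_{τ : ∂τ = γ} Z*_K[τ] = 2^{|C₃|} e^{K|C₂⁺|} Σ_{η : ∂η = γ} (e^{-2K})^{|supp η|}` — on the twisted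
low-temperature side `τ ↦ τ + ∂₃ s` is a bijection of `{∂τ = γ}` (`∂₂∂₃ = 0`), so every spin
configuration contributes the full high-temperature-type sum.
[cite: Wegner1971, §III.A eqs. (3.27)–(3.30) (periodic boundary conditions: degeneracy factors 2^{N_m})] -/
theorem sum_dualSpinZ_eq (K : ℝ) (γ : Site d L → Fin d → ZMod 2) :
    ∑ τ : Plaquette d L → ZMod 2, (if bd₂ τ = γ then dualSpinZ K τ else 0) =
      (2 : ℝ) ^ Fintype.card (Cell₃ d L) * Real.exp K ^ Fintype.card (Plaquette d L) *
        ∑ η : Plaquette d L → ZMod 2,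
          (if bd₂ η = γ then Real.exp (-(2 * K)) ^ (supp η).card else 0) := by
  classical
  -- expand every `Z*_K[τ]` and swap the sums
  have h1 : ∑ τ : Plaquette d L → ZMod 2, (if bd₂ τ = γ then dualSpinZ K τ else 0) =
      Real.exp K ^ Fintype.card (Plaquette d L) *
        ∑ s : Cell₃ d L → ZMod 2, ∑ τ : Plaquette d L → ZMod 2,
          (if bd₂ τ = γ then Real.exp (-(2 * K)) ^ (supp (bd₃ s + τ)).card else 0) := by
    rw [Finset.sum_comm, Finset.mul_sum]
    refine Finset.sum_congr rfl fun τ _ => ?_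
    split_ifs with hτ
    · rw [dualSpinZ_eq_lowTemp, Finset.mul_sum]
    · simp
  -- for each `s`, reindex `τ ↦ τ + ∂₃ s`
  have h2 : ∀ s : Cell₃ d L → ZMod 2, ∑ τ : Plaquette d L → ZMod 2,
      (if bd₂ τ = γ then Real.exp (-(2 * K)) ^ (supp (bd₃ s + τ)).card else 0) =
      ∑ η : Plaquette d L → ZMod 2,
        (if bd₂ η = γ then Real.exp (-(2 * K)) ^ (supp η).card else 0) := by
    intro s
    rw [← Equiv.sum_comp (Equiv.addRight (bd₃ s))]
    refine Finset.sum_congr rfl fun τ _ => ?_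
    rw [Equiv.coe_addRight]
    have hbd : bd₂ (τ + bd₃ s) = bd₂ τ := by
      have := (bd₂Lin (d := d) (L := L) (ZMod 2)).map_add τ (bd₃ s)
      simp only [bd₂Lin_apply] at this
      rw [this, bd₂_bd₃, add_zero]
    have hsupp : bd₃ s + (τ + bd₃ s) = τ := by
      funext σ
      simp only [Pi.add_apply]
      have h2 : ∀ a : ZMod 2, a + a = 0 := by decide
      calc bd₃ s σ + (τ σ + bd₃ s σ) = τ σ + (bd₃ s σ + bd₃ s σ) := by ring
        _ = τ σ := by rw [h2, add_zero]
    rw [hbd, hsupp]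
  rw [h1]
  simp_rw [h2]
  rw [Finset.sum_const, Finset.card_univ, nsmul_eq_mul, Fintype.card_fun, ZMod.card,
    Nat.cast_pow, Nat.cast_ofNat]
  ring

/-! ### The dual coupling `tanh 2β = e^{-2K*}` -/

/-- Wegner's dual coupling `K* = -½ log tanh 2β` (his eq. (3.28) `tanh K = e^{-2K*}` with the gauge
coupling `K = 2β` of the normalisation `e^{-βS} = ∏_{p ∈ C₂⁺} e^{2βρ(dσ(p))}`).
[cite: Wegner1971, §III.A eq. (3.28); Wipf2021, §10.3 eq. (10.41)] -/
noncomputable def dualCoupling (β : ℝ) : ℝ := -(Real.log (Real.tanh (2 * β))) / 2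

/-- `e^{-2K*} = tanh 2β` for `β > 0`. [cite: Wegner1971, §III.A eq. (3.28)] -/
theorem exp_neg_two_mul_dualCoupling {β : ℝ} (hβ : 0 < β) :
    Real.exp (-(2 * dualCoupling β)) = Real.tanh (2 * β) := by
  unfold dualCoupling
  rw [show -(2 * (-Real.log (Real.tanh (2 * β)) / 2)) = Real.log (Real.tanh (2 * β)) by ring]
  exact Real.exp_log (tanh_two_mul_pos hβ)

/-- `tanh 2β < 1`. [cite: Wipf2021, §10.3 (Fig. 10.4: *K(K))] -/
theorem tanh_two_mul_lt_one (β : ℝ) : Real.tanh (2 * β) < 1 := by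
  rw [Real.tanh_eq_sinh_div_cosh, div_lt_one (Real.cosh_pos _)]
  have := Real.cosh_sub_sinh (2 * β)
  linarith [Real.exp_pos (-(2 * β))]

/-- `K* > 0` for `β > 0` (high temperature ↔ low temperature). [cite: Wegner1971, §III.A eq. (3.28)] -/
theorem dualCoupling_pos {β : ℝ} (hβ : 0 < β) : 0 < dualCoupling β := by
  unfold dualCoupling
  have h := Real.log_neg (tanh_two_mul_pos hβ) (tanh_two_mul_lt_one β)
  linarith

/-! ### Wegner's duality -/

/-- **Wegner's duality for Ising lattice gauge theory on the torus `𝕋^d_L`, PROVED**: for every `β`,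
every `K` with `e^{-2K} = tanh 2β` (e.g. `K = dualCoupling β`, `β > 0`) and every `ℤ₂` `1`-chain `γ`,
`Σ_{τ : ∂τ = γ} Z*_K[τ] = 2^{|C₃|} e^{K|C₂⁺|} · Z_β[γ] / (|Ω¹(𝕋;ℤ₂)| (cosh 2β)^{|C₂⁺|})` — the
Wilson-loop numerator of the gauge theory at `β` equals, up to an explicit constant, the sum over
all twists bounded by `γ` of the twisted partition functions of the dual model at `K`; for `γ = 0`
and `d = 3`: the `ℤ₂` gauge partition function is the sum over the `H₂(𝕋³;ℤ₂)`-sectors of seamed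
Ising partition functions on the dual torus (Wegner's `M_{32} ↔ M*_{31}` with his periodic-boundary
degeneracy made explicit). Proof: high-temperature expansion (`loopNumerator_eq_htSum`) against the
low-temperature expansion of the dual model (`sum_dualSpinZ_eq`).
[cite: Wegner1971, §III.A eqs. (3.27)–(3.28); Wipf2021, §10.3 eq. (10.45)] -/
theorem sum_dualSpinZ_eq_loopNumerator {β K : ℝ} (hK : Real.exp (-(2 * K)) = Real.tanh (2 * β))
    (γ : Site d L → Fin d → ZMod 2) :
    ∑ τ : Plaquette d L → ZMod 2, (if bd₂ τ = γ then dualSpinZ K τ else 0) =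
      (2 : ℝ) ^ Fintype.card (Cell₃ d L) * Real.exp K ^ Fintype.card (Plaquette d L) *
        (loopNumerator β γ / (Fintype.card (Site d L → Fin d → ZMod 2) *
          Real.cosh (2 * β) ^ Fintype.card (Plaquette d L))) := by
  have hcard : (Fintype.card (Site d L → Fin d → ZMod 2) : ℝ) ≠ 0 := by
    exact_mod_cast Fintype.card_ne_zero
  have hc : Real.cosh (2 * β) ^ Fintype.card (Plaquette d L) ≠ 0 := pow_ne_zero _ (Real.cosh_pos _).ne'
  rw [sum_dualSpinZ_eq, loopNumerator_eq_htSum, hK]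
  unfold htSum htWeight
  field_simp

/-- **Wilson loops as ratios of twisted dual partition functions (disorder representation), PROVED on
the torus**: for every `β`, `K` with `e^{-2K} = tanh 2β` and every `ℤ₂` `1`-chain `γ`,
`𝔼_β[W_γ] = Z_β[γ]/Z_β[0] = Σ_{τ : ∂τ = γ} Z*_K[τ] / Σ_{τ : ∂τ = 0} Z*_K[τ]` (for `d = 3`: the `ℤ₂`
Wilson loop is the sector-summed free-energy cost of an Ising interface bounded by `γ` on the dual
torus). [cite: Wegner1971, §III.B (correlation functions under duality); Wipf2021, §10.3.1 eq. (10.43)] -/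
theorem wilsonExpect_eq_dualSpinZ_ratio {β K : ℝ}
    (hK : Real.exp (-(2 * K)) = Real.tanh (2 * β)) (γ : Site d L → Fin d → ZMod 2) :
    loopNumerator β γ / loopNumerator (d := d) (L := L) β 0 =
      (∑ τ : Plaquette d L → ZMod 2, (if bd₂ τ = γ then dualSpinZ K τ else 0)) /
        ∑ τ : Plaquette d L → ZMod 2, (if bd₂ τ = 0 then dualSpinZ K τ else 0) := by
  have hcard : (Fintype.card (Site d L → Fin d → ZMod 2) : ℝ) ≠ 0 := by
    exact_mod_cast Fintype.card_ne_zero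
  have hc : Real.cosh (2 * β) ^ Fintype.card (Plaquette d L) ≠ 0 := pow_ne_zero _ (Real.cosh_pos _).ne'
  have h2 : (2 : ℝ) ^ Fintype.card (Cell₃ d L) ≠ 0 := pow_ne_zero _ two_ne_zero
  have he : Real.exp K ^ Fintype.card (Plaquette d L) ≠ 0 := pow_ne_zero _ (Real.exp_pos _).ne'
  have hZ := (loopNumerator_zero_pos (d := d) (L := L) β).ne'
  rw [sum_dualSpinZ_eq_loopNumerator hK, sum_dualSpinZ_eq_loopNumerator hK]
  field_simp

/-! ### `d = 3`: the kernel of `∂₃` on `𝕋³_L` is the constants -/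

/-- On `𝕋³_L` with `ℤ₂` coefficients, `∂₃ s = 0` iff the cube function `s` is constant: the only
degeneracy of the spin ↦ domain-wall map of the dual Ising model is the global spin flip.
[cite: Wipf2021, §10.3.1 (equivalent configurations)] -/
theorem bd₃_eq_zero_iff_const {L : ℕ} [NeZero L] (s : Cell₃ 3 L → ZMod 2) :
    bd₃ s = 0 ↔ ∀ c c' : Cell₃ 3 L, s c = s c' := by
  classical
  constructor
  · intro h
    -- invariance under the unit translations
    have hstep : ∀ (z : Site 3 L) (π : Dual3.Plane),
        s (z - te (Dual3.complDir π.1.1 π.1.2), Dual3.top) = s (z, Dual3.top) := by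
      intro z π
      have hσ := congrFun h (z, π)
      rw [bd₃_apply_three, Pi.zero_apply, mul_eq_zero] at hσ
      rcases hσ with h0 | h0
      · exact absurd h0 (faceSign_cast_ne_zero π)
      · exact sub_eq_zero.mp h0
    have hdir : ∀ (c : Fin 3), ∃ π : Dual3.Plane, Dual3.complDir π.1.1 π.1.2 = c := by decide
    have hsub : ∀ (z : Site 3 L) (c : Fin 3), s (z - te c, Dual3.top) = s (z, Dual3.top) := by
      intro z c
      obtain ⟨π, hπ⟩ := hdir c
      rw [← hπ]
      exact hstep z π
    have hadd : ∀ (z : Site 3 L) (c : Fin 3) (n : ℕ),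
        s (z + n • te c, Dual3.top) = s (z, Dual3.top) := by
      intro z c n
      induction n with
      | zero => simp
      | succ n ih =>
        rw [succ_nsmul, ← add_assoc, ← hsub (z + n • te c + te c) c, add_sub_cancel_right, ih]
    have hsingle : ∀ (z : Site 3 L) (c : Fin 3) (a : ZMod L),
        s (z + Pi.single c a, Dual3.top) = s (z, Dual3.top) := by
      intro z c a
      have ha : (Pi.single c a : Site 3 L) = a.val • te c := by
        funext j
        simp only [te, Pi.smul_apply, Pi.single_apply, nsmul_eq_mul]
        split_ifs
        · rw [mul_one, ZMod.natCast_zmod_val]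
        · rw [mul_zero]
      rw [ha, hadd]
    -- every site is reached from `0` by coordinate translations
    have hall : ∀ z : Site 3 L, s (z, Dual3.top) = s (0, Dual3.top) := by
      intro z
      have hz : z = 0 + Pi.single 0 (z 0) + Pi.single 1 (z 1) + Pi.single 2 (z 2) := by
        funext i
        fin_cases i <;> simp
      rw [hz, hsingle, hsingle, hsingle]
    intro c c'
    obtain ⟨z, T⟩ := c
    obtain ⟨z', T'⟩ := c'
    rw [Dual3.eq_top T, Dual3.eq_top T', hall z, hall z']
  · intro h
    funext σ
    obtain ⟨z, π⟩ := σ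
    rw [bd₃_apply_three, Pi.zero_apply,
      h (z - te (Dual3.complDir π.1.1 π.1.2), Dual3.top) (z, Dual3.top), sub_self, mul_zero]

/-! ### `d = 3`: one twisted Ising partition function sees exactly one `H₂`-sector -/

/-- `∂₃` of a constant `3`-chain vanishes on `𝕋³_L` (`ℤ₂` coefficients). [cite: Wipf2021, §10.3.1 (equivalent configurations)] -/
theorem bd₃_const_three {L : ℕ} [NeZero L] (a : ZMod 2) : bd₃ (fun _ : Cell₃ 3 L => a) = 0 :=
  (bd₃_eq_zero_iff_const _).mpr fun _ _ => rfl

/-- **The fibres of `s ↦ ∂₃ s + τ` on `𝕋³_L` have exactly two elements** (`s` and its global flip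
`s + 1`) when non-empty. [cite: Wipf2021, §10.3.1 (equivalent configurations); Wegner1971, §III.A eq. (3.21) (degeneracy 2^{N_g})] -/
theorem card_fibre_bd₃_three {L : ℕ} [NeZero L] (τ η : Plaquette 3 L → ZMod 2) :
    (Finset.univ.filter (fun s : Cell₃ 3 L → ZMod 2 => bd₃ s + τ = η)).card =
      if ∃ w : Cell₃ 3 L → ZMod 2, bd₃ w + τ = η then 2 else 0 := by
  classical
  have h2 : ∀ a : ZMod 2, a + a = 0 := by decide
  split_ifs with h
  · obtain ⟨w, hw⟩ := h
    set one : Cell₃ 3 L → ZMod 2 := fun _ => 1 with hone_def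
    have hflip : ∀ a : ZMod 2, a ≠ a + 1 := by decide
    have hne : w ≠ w + one := by
      intro h0
      have := congrFun h0 ((0 : Site 3 L), Dual3.top)
      rw [Pi.add_apply, hone_def] at this
      exact hflip _ this
    have hfib : Finset.univ.filter (fun s : Cell₃ 3 L → ZMod 2 => bd₃ s + τ = η) = {w, w + one} := by
      ext s
      simp only [Finset.mem_filter, Finset.mem_univ, true_and, Finset.mem_insert,
        Finset.mem_singleton]
      constructor
      · intro hs
        have hsw : bd₃ (s + w) = 0 := by
          have h1 : bd₃ s = bd₃ w := add_right_cancel (hs.trans hw.symm)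
          rw [bd₃_add, h1]
          funext σ
          exact h2 _
        rw [bd₃_eq_zero_iff_const] at hsw
        have hz : ∀ a : ZMod 2, a = 0 ∨ a = 1 := by decide
        rcases hz ((s + w) (0, Dual3.top)) with h0 | h1
        · left
          funext c
          have hc := hsw c (0, Dual3.top)
          rw [h0, Pi.add_apply] at hc
          -- `s c + w c = 0` in `ℤ₂` means `s c = w c`
          have : s c = s c + (w c + w c) := by rw [h2, add_zero]
          rw [this, ← add_assoc, hc, zero_add]
        · right
          funext c
          have hc := hsw c (0, Dual3.top)
          rw [h1, Pi.add_apply] at hc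
          rw [Pi.add_apply, hone_def]
          have : s c = s c + (w c + w c) := by rw [h2, add_zero]
          rw [this, ← add_assoc, hc, add_comm]
      · rintro (rfl | rfl)
        · exact hw
        · rw [bd₃_add, hone_def, bd₃_const_three, add_zero, hw]
    rw [hfib, Finset.card_pair hne]
  · rw [Finset.card_eq_zero, Finset.filter_eq_empty_iff]
    intro s _ hs
    exact h ⟨s, hs⟩

/-- **On `𝕋³_L` a twisted dual Ising partition function is the sum over ONE `H₂`-coset**:
`Z*_K[τ] = 2 e^{K|C₂⁺|} Σ_{η ∈ τ + ∂₃C₃} (e^{-2K})^{|supp η|}` (the factor `2` is the global spin flip).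
[cite: Wegner1971, §III.A eqs. (3.21)–(3.30) (degeneracy factors for periodic boundary conditions); Wipf2021, §10.3 eq. (10.40)] -/
theorem dualSpinZ_three_eq {L : ℕ} [NeZero L] (K : ℝ) (τ : Plaquette 3 L → ZMod 2) :
    dualSpinZ (d := 3) (L := L) K τ = 2 * Real.exp K ^ Fintype.card (Plaquette 3 L) *
      ∑ η : Plaquette 3 L → ZMod 2,
        (if ∃ w : Cell₃ 3 L → ZMod 2, bd₃ w + τ = η then
          Real.exp (-(2 * K)) ^ (supp η).card else 0) := by
  classical
  rw [dualSpinZ_eq_lowTemp]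
  -- regroup the spin configurations by their domain-wall configuration `η = ∂₃ s + τ`
  have hregroup : ∑ s : Cell₃ 3 L → ZMod 2, Real.exp (-(2 * K)) ^ (supp (bd₃ s + τ)).card =
      ∑ η : Plaquette 3 L → ZMod 2,
        ((Finset.univ.filter (fun s : Cell₃ 3 L → ZMod 2 => bd₃ s + τ = η)).card : ℝ) *
          Real.exp (-(2 * K)) ^ (supp η).card := by
    have hstep : ∀ s : Cell₃ 3 L → ZMod 2, Real.exp (-(2 * K)) ^ (supp (bd₃ s + τ)).card =
        ∑ η : Plaquette 3 L → ZMod 2,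
          (if bd₃ s + τ = η then Real.exp (-(2 * K)) ^ (supp η).card else 0) := by
      intro s
      rw [Finset.sum_ite_eq, if_pos (Finset.mem_univ _)]
    simp_rw [hstep]
    rw [Finset.sum_comm]
    refine Finset.sum_congr rfl fun η _ => ?_
    rw [← Finset.sum_filter, Finset.sum_const, nsmul_eq_mul]
  have hfib : ∑ η : Plaquette 3 L → ZMod 2,
      ((Finset.univ.filter (fun s : Cell₃ 3 L → ZMod 2 => bd₃ s + τ = η)).card : ℝ) *
        Real.exp (-(2 * K)) ^ (supp η).card =
      2 * ∑ η : Plaquette 3 L → ZMod 2,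
        (if ∃ w : Cell₃ 3 L → ZMod 2, bd₃ w + τ = η then
          Real.exp (-(2 * K)) ^ (supp η).card else 0) := by
    rw [Finset.mul_sum]
    refine Finset.sum_congr rfl fun η _ => ?_
    rw [card_fibre_bd₃_three]
    split_ifs <;> simp
  rw [hregroup, hfib]
  ring

/-- **The untwisted case**: the Ising partition function on the dual torus equals
`2 e^{K|C₂⁺|} Σ_{η ∈ B₂(𝕋³_L;ℤ₂)} (e^{-2K})^{|supp η|}` — it sees only the `2`-BOUNDARIES, i.e. the
trivial sector of the gauge theory's high-temperature expansion (which runs over all `2`-cycles).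
[cite: Wegner1971, §III.A eq. (3.30); Wipf2021, §10.3 eq. (10.45)] -/
theorem dualSpinZ_three_zero_eq {L : ℕ} [NeZero L]
    [DecidablePred (IsTwoBoundary (d := 3) (L := L) (R := ZMod 2))] (K : ℝ) :
    dualSpinZ (d := 3) (L := L) K 0 = 2 * Real.exp K ^ Fintype.card (Plaquette 3 L) *
      ∑ η : Plaquette 3 L → ZMod 2,
        (if IsTwoBoundary η then Real.exp (-(2 * K)) ^ (supp η).card else 0) := by
  have hsum : ∑ η : Plaquette 3 L → ZMod 2,
      (if ∃ w : Cell₃ 3 L → ZMod 2, bd₃ w + 0 = η then Real.exp (-(2 * K)) ^ (supp η).card else 0) =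
      ∑ η : Plaquette 3 L → ZMod 2,
        (if IsTwoBoundary η then Real.exp (-(2 * K)) ^ (supp η).card else 0) := by
    refine Finset.sum_congr rfl fun η _ => ?_
    have hiff : (∃ w : Cell₃ 3 L → ZMod 2, bd₃ w + 0 = η) ↔ IsTwoBoundary η := by
      constructor
      · rintro ⟨w, hw⟩
        rw [add_zero] at hw
        exact ⟨w, hw⟩
      · rintro ⟨w, hw⟩
        exact ⟨w, by rw [add_zero]; exact hw⟩
    by_cases h : IsTwoBoundary η
    · rw [if_pos h, if_pos (hiff.mpr h)]
    · rw [if_neg h, if_neg (fun h' => h (hiff.mp h'))]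
  rw [dualSpinZ_three_eq, hsum]

/-- **The Ising model on the dual torus against the gauge theory: the trivial sector is a lower
bound.** For `e^{-2K} = tanh 2β`,
`Z^{Ising}_K(𝕋³_L dual) = Z*_K[0] ≤ 2 e^{K|C₂⁺|} Z_β[0] / (|Ω¹| (cosh 2β)^{|C₂⁺|})`
(`B₂ ⊆ Z₂`; equality would require `H₂(𝕋³_L;ℤ₂) = 0`, false on the torus — Wegner's remark that for
periodic boundary conditions the duality holds only up to the sector degeneracy).
[cite: Wegner1971, §III.A eqs. (3.27)–(3.30)] -/
theorem dualSpinZ_three_zero_le {L : ℕ} [NeZero L] {β K : ℝ}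
    (hK : Real.exp (-(2 * K)) = Real.tanh (2 * β)) :
    dualSpinZ (d := 3) (L := L) K 0 ≤ 2 * Real.exp K ^ Fintype.card (Plaquette 3 L) *
      (loopNumerator (d := 3) (L := L) β 0 / (Fintype.card (Site 3 L → Fin 3 → ZMod 2) *
        Real.cosh (2 * β) ^ Fintype.card (Plaquette 3 L))) := by
  classical
  have hcard : (Fintype.card (Site 3 L → Fin 3 → ZMod 2) : ℝ) ≠ 0 := by
    exact_mod_cast Fintype.card_ne_zero
  have hc : Real.cosh (2 * β) ^ Fintype.card (Plaquette 3 L) ≠ 0 := pow_ne_zero _ (Real.cosh_pos _).ne'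
  have hZ : loopNumerator (d := 3) (L := L) β 0 / (Fintype.card (Site 3 L → Fin 3 → ZMod 2) *
      Real.cosh (2 * β) ^ Fintype.card (Plaquette 3 L)) =
      ∑ η : Plaquette 3 L → ZMod 2,
        (if bd₂ η = 0 then Real.exp (-(2 * K)) ^ (supp η).card else 0) := by
    rw [loopNumerator_eq_htSum, hK]
    unfold htSum htWeight
    field_simp
  rw [hZ, dualSpinZ_three_zero_eq]
  refine mul_le_mul_of_nonneg_left (Finset.sum_le_sum fun η _ => ?_) (by positivity)
  by_cases hB : IsTwoBoundary η
  · obtain ⟨w, hw⟩ := hB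
    have hZ2 : bd₂ η = 0 := by rw [← hw]; exact bd₂_bd₃ (ZMod 2) w
    rw [if_pos ⟨w, hw⟩, if_pos hZ2]
  · rw [if_neg hB]
    split_ifs
    · positivity
    · exact le_rfl

end IsingGaugeCurrents

end Literature.MathematicalPhysics.QuantumFieldTheory
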